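import Summits.CriticalPhenomena.SAWScalingLimit.Theses.SAWDefectDecoherence
import Literature.Analysis.Complex.WeylLemmaDbar

/-!
# Pick engine, STAGE 1 glue (line `pick-half-plane`, stub `stub_pickEngine`): Weyl's lemma step

Support file for crux `BoundaryClosureR` (stmt-CriticalPhenomena-14004), line `pick-half-plane`,
stub `stub_pickEngine`.  STAGE 1 of the engine must turn the normalised functionals
`N_δ(ψ) = δ² Σ_{z ∈ Ω_δ} ψ(δ·mid z) F_δ(z) / F_δ(b_δ)` along a mesh sequence into an INTERIOR PICK
LIMIT (`IsInteriorPickLimit`, skeleton §2) that is their weak limit (`IsWeakLimit`, §1).  The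
re-scoped route (lead, wave 3): compactness of the functionals from `LocalL1Bound` (dual-norm
bounds on each `C(K)`), holomorphy of the limit for free from the route's weak `∂̄`-closure
(`DefectDecoherence → MassRatio → ConjugateClassNegligible`, `DecoherenceSynthesis`) by WEYL'S LEMMA
for `∂/∂z̄`, and the Pick data from the limits of the developing maps.  This file is the glue
around the Weyl step, with every remaining analytic input an explicit hypothesis:

* (S1) a subsequential weak limit AS A LOCALLY INTEGRABLE FUNCTION `g₀` on the carrier (weak-*
  compactness from `LocalL1Bound` + absolute continuity of the limit measure);
* (S2) the weak `∂̄`-closure IN THE LIMIT: `∫ g₀ ∂̄φ = 0` for smooth `φ` compactly supported in the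
  carrier (from `ConjugateClassNegligible` and the vertex relation by summation by parts);
* (S3) the limit `h` of the normalised developing maps: holomorphic on the carrier, `h' = α g₀`
  almost everywhere, not constant, with the global root-frame wedge `-M ≤ re (ω̄ h)` on the carrier
  (`HalfPlaneBounds`, root frame, skeleton r5b: `δ((H s).re - (H sb).re) ≤ M ‖F₀(b δ)‖` and the
  sorry-free `rootFrame_identity`) passed to the limit.

From these, Weyl's lemma (`Literature.Analysis.Complex.weyl_dbar`, landed for this purpose)
replaces `g₀` by its holomorphic representative `g`; `h' = α g` everywhere by continuity
(`Measure.eqOn_open_of_ae_eq`); the weak limits are unchanged (`ψ g₀ = ψ g` a.e.); and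
`g ≢ 0` because `h` is not constant: `IsInteriorPickLimit D ρ x r g ∧ IsWeakLimit D Λ e b ns g`
(both unfolded).  Main result: `pickEngine_stage1` (registered sub-goal of `stub_pickEngine`).
References: H. Weyl (1940); Hörmander, *ALPDO I*, Thm. 4.4.1; Duminil-Copin–Smirnov (2012).
-/

noncomputable section

open scoped Topology ComplexConjugate ContDiff
open Filter Set Metric MeasureTheory
open Literature.Probability.LatticeModels Literature.Probability.RandomPlanarGeometry
open Literature.Probability.RandomPlanarGeometry.SAW
open Literature.Analysis.Complex

namespace Summit.CriticalPhenomena.SAWScalingLimit.Theorems.PickHalfPlane.Engine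

/-- **STAGE 1 of the Pick engine modulo compactness and boundary data (registered sub-goal
`pickEngine_stage1` of stub `stub_pickEngine`).** Along a mesh sequence `ns`, suppose the
normalised functionals converge weakly to a locally integrable `g₀` on the carrier (S1), `g₀` is
weakly `∂̄`-closed (S2), and `h` is a holomorphic function on the carrier with `h' = α g₀` a.e.,
`h' ≢ 0`, carrying the root-frame wedge `-M ≤ re (ω̄ h)` on the carrier (S3). Then the holomorphic representative `g` of `g₀`
given by Weyl's lemma is an interior Pick limit and the weak limit of the functionals:
`IsInteriorPickLimit D ρ x r g ∧ IsWeakLimit D Λ e b ns g` (skeleton §§1–2, unfolded). [folklore] -/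
theorem pickEngine_stage1 :
    ∀ (D : DobrushinDomain) (ρ : ℝ) (x : ℂ) (r : ℝ) (Λ : ℝ → Finset HexVertex)
      (e b : ℝ → Sym2 HexVertex) (ns : ℕ → ℝ) (g₀ h : ℂ → ℂ) (α om : ℂ),
      LocallyIntegrableOn g₀ D.carrier →
      (∀ ψ : ℂ → ℂ, Continuous ψ → HasCompactSupport ψ → tsupport ψ ⊆ D.carrier →
        Tendsto (fun n => ((ns n : ℝ) : ℂ) ^ 2 * (∑ᶠ z ∈ hexDomainMidEdges (Λ (ns n)),
            ψ (((ns n : ℝ) : ℂ) * hexMidpoint z) *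
              hexParafermionicObservable (Λ (ns n)) (e (ns n)) hexCriticalFugacity (5 / 8) z) /
          hexParafermionicObservable (Λ (ns n)) (e (ns n)) hexCriticalFugacity (5 / 8) (b (ns n)))
          atTop (𝓝 (∫ z, ψ z * g₀ z))) →
      (∀ φ : ℂ → ℂ, ContDiff ℝ ∞ φ → HasCompactSupport φ → tsupport φ ⊆ D.carrier →
        ∫ z, g₀ z * dbarAlong 1 φ z = 0) →
      α ≠ 0 → ‖om‖ = 1 → DifferentiableOn ℂ h D.carrier →
      (∀ᵐ z ∂volume, z ∈ D.carrier → deriv h z = α * g₀ z) →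
      (∃ z ∈ D.carrier, deriv h z ≠ 0) →
      (∃ M : ℝ, ∀ z ∈ D.carrier, -M ≤ ((starRingEnd ℂ) om * h z).re) →
      ∃ g : ℂ → ℂ,
        (DifferentiableOn ℂ g D.carrier ∧ (∃ z ∈ D.carrier, g z ≠ 0) ∧
          ∃ (h : ℂ → ℂ) (α om : ℂ), α ≠ 0 ∧ ‖om‖ = 1 ∧ DifferentiableOn ℂ h D.carrier ∧
            (∀ z ∈ D.carrier, deriv h z = α * g z) ∧
            (∃ M : ℝ, ∀ z ∈ D.carrier, -M ≤ ((starRingEnd ℂ) om * h z).re)) ∧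
        (∀ ψ : ℂ → ℂ, (Continuous ψ ∧ HasCompactSupport ψ ∧ tsupport ψ ⊆ D.carrier) →
          Tendsto (fun n => ((ns n : ℝ) : ℂ) ^ 2 * (∑ᶠ z ∈ hexDomainMidEdges (Λ (ns n)),
              ψ (((ns n : ℝ) : ℂ) * hexMidpoint z) *
                hexParafermionicObservable (Λ (ns n)) (e (ns n)) hexCriticalFugacity (5 / 8) z) /
            hexParafermionicObservable (Λ (ns n)) (e (ns n)) hexCriticalFugacity (5 / 8) (b (ns n)))
            atTop (𝓝 (∫ z, ψ z * g z))) := by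
  intro D ρ x r Λ e b ns g₀ h α om hg₀ hweak hdbar hα hom hhol hderiv hnc hpick
  have hopen : IsOpen D.carrier := D.isOpen
  -- Weyl's lemma: the holomorphic representative
  obtain ⟨g, hg, hae⟩ := weyl_dbar hopen hg₀ hdbar
  -- `h' = α g` everywhere on the carrier, by continuity
  have hdh : DifferentiableOn ℂ (deriv h) D.carrier :=
    ((hhol.analyticOnNhd hopen).deriv).differentiableOn
  have heq : EqOn (deriv h) (fun z => α * g z) D.carrier := by
    refine Measure.eqOn_open_of_ae_eq (μ := volume) ?_ hopen hdh.continuousOn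
      ((continuousOn_const.mul hg.continuousOn))
    rw [EventuallyEq, ae_restrict_iff' hopen.measurableSet]
    filter_upwards [hderiv, hae] with z hz hz' hzU
    rw [hz hzU, hz' hzU]
  refine ⟨g, ⟨hg, ?_, h, α, om, hα, hom, hhol, fun z hz => heq hz, hpick⟩, ?_⟩
  · obtain ⟨z, hz, hz0⟩ := hnc
    refine ⟨z, hz, fun h0 => hz0 ?_⟩
    rw [heq hz]
    show α * g z = 0
    rw [h0, mul_zero]
  · rintro ψ ⟨hψc, hψK, hψD⟩
    have hint : ∫ z, ψ z * g z = ∫ z, ψ z * g₀ z := by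
      refine integral_congr_ae ?_
      filter_upwards [hae] with z hz
      by_cases hzU : z ∈ D.carrier
      · rw [hz hzU]
      · rw [image_eq_zero_of_notMem_tsupport fun h' => hzU (hψD h'), zero_mul, zero_mul]
    rw [hint]
    exact hweak ψ hψc hψK hψD

end Summit.CriticalPhenomena.SAWScalingLimit.Theorems.PickHalfPlane.Engine

end
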